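import Summits.Ventures.YMGap.RobustBall.TorusClustering
import Summits.Ventures.YMGap.Thresholds.QuarterModulusTwoThirds
import HarnessLib

/-!
# Venture YMGap, track ROBUST-BALL (Y2) — `SU(2)`, `d = 4` torus clustering ROWS on the quarter modulus
(row `RowClusteringSU2OneEighthQuarter` of `RobustBall/Targets` and its neighbours on the grid)

HONEST FRAMING. WHAT THIS IS: a venture file (cell `pub-ymgap`, track Y2 ROBUST-BALL, seat ds-2): CERTIFIED
ROWS of the robust torus door for `SU(2)` in `d = 4` through the tree's QUARTER one-link modulus
(`QuarterModulusTwoThirds.oneLinkKRModulusSU2_of_le_twoThirds`: `OneLinkKRModulus 2 (3β_W/2) 1` for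
`β_W ≤ 2/3`, kernel-certified), i.e. the door `Qgap` of the cell's certificate tables (rb-theory `rb_rows`,
rb-ref lineage R): Wilson constant `c_W = K (|β|/N) 6(d−1) = (9/2) β_W` at tree coupling `β = β_W/2`, one-parameter
ball `ε₀ = 2ε`, `ε₁ = ε`, row `rhoFR 2 ((9/2)β_W) (2ε) ε < 1` certified IN THE KERNEL by exact rational
arithmetic from the Taylor majorant of `exp` (Mathlib `Real.exp_bound'`) and `√2 ≤ 1.41422`:
`(β_W, ε) = (1/8, 13/100)`, `(1/6, 31/500)`, `(1/5, 11/500)` — the three `Qgap` entries of the tables, digit for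
digit — and the two TIER-2 (diameter-weighted) quarter rows `(β_W, κ, ε) = (1/8, log(6/5), 43/500)`, `(1/8, log(3/2), 9/250)`
(HEADLINE-CANDIDATES 2b). Each tier-1 row is the HYPOTHESIS-FREE theorem «every member of `ClusterDomainFR (2ε) ε r` on
every torus `(ℤ/L)⁴`, `L ≥ 3`, clusters exponentially under its own perturbed measure with constant `16` and rate
`−log ρ/(r ⊔ 1)`», `ρ` the certified row value; each tier-2 row gives rate `κ` on `ClusterDomain κ (2ε) ε`;
`rowClusteringSU2OneEighthQuarter_holds` and `rowClusteringSU2OneEighth_holds` are the two Targets clustering rows by name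
(the second — typed for the variance door at radius `97/1000` — is INSIDE the quarter door's radius `13/100`, so the quarter
door discharges it too).
WHAT THIS IS NOT: not the variance-door rows (`RowClusteringSU2OneEighth`, rb-p1's lineage), not a `ℤ^4` / DLR
statement, no area law, no claim beyond the strong-coupling lattice regime; no continuum, no Millennium claim.

## References
* rb-theory, `HOME/rb/certs/rb_rows.md` (column `Qgap`); rb-ref, `HOME/rb/referee/LINEAGE-R.md` (`Qgap 1/8 → 130,
  1/6 → 62, 1/5 → 22`, all `/1000`) — reproduced here in the kernel.
* H. Föllmer, LNM 1362 (1988), Ch. I (2.7)–(2.24); H. Shen, R. Zhu, X. Zhu, CMP 400 (2023) 805, Rem. 1.3.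
-/

noncomputable section

open MeasureTheory ProbabilityTheory Finset Function Real
open Literature.Probability.LatticeModels Literature.Probability.LatticeModels.DobrushinMetric
open Literature.MathematicalPhysics.QuantumLattice hiding torusNorm
open Literature.MathematicalPhysics.QuantumFieldTheory hiding ZdEdge
open Literature.MathematicalPhysics.QuantumFieldTheory.Balaban1983to89.StrongCouplingTorusWindow
open Literature.MathematicalPhysics.QuantumFieldTheory.Balaban1983to89.StrongCouplingDobrushinWindow
  (OneLinkKRModulus OneLinkKRModulusSU2)

namespace Summit.Ventures.YMGap.RobustBall

/-! ### Numerical bounds -/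

/-- `e^{13/50} ≤ 1.297` (Taylor majorant, Mathlib's `Real.exp_bound'`). [folklore] -/
theorem exp_thirteen_fiftieths_le : Real.exp (13 / 50) ≤ 1.297 := by
  have h := Real.exp_bound' (x := 13 / 50) (by norm_num) (by norm_num) (n := 5) (by norm_num)
  refine h.trans ?_
  simp only [Finset.sum_range_succ, Finset.sum_range_zero, Nat.factorial]
  norm_num

/-- `e^{31/250} ≤ 1.13202`. [folklore] -/
theorem exp_thirtyone_twofiftieths_le : Real.exp (31 / 250) ≤ 1.13202 := by
  have h := Real.exp_bound' (x := 31 / 250) (by norm_num) (by norm_num) (n := 5) (by norm_num)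
  refine h.trans ?_
  simp only [Finset.sum_range_succ, Finset.sum_range_zero, Nat.factorial]
  norm_num

/-- `e^{11/250} ≤ 1.044983`. [folklore] -/
theorem exp_eleven_twofiftieths_le : Real.exp (11 / 250) ≤ 1.044983 := by
  have h := Real.exp_bound' (x := 11 / 250) (by norm_num) (by norm_num) (n := 5) (by norm_num)
  refine h.trans ?_
  simp only [Finset.sum_range_succ, Finset.sum_range_zero, Nat.factorial]
  norm_num

/-- `e^{43/250} ≤ 1.18768`. [folklore] -/
theorem exp_fortythree_twofiftieths_le : Real.exp (43 / 250) ≤ 1.18768 := by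
  have h := Real.exp_bound' (x := 43 / 250) (by norm_num) (by norm_num) (n := 5) (by norm_num)
  refine h.trans ?_
  simp only [Finset.sum_range_succ, Finset.sum_range_zero, Nat.factorial]
  norm_num

/-- `e^{9/125} ≤ 1.074656`. [folklore] -/
theorem exp_nine_onetwentyfifths_le : Real.exp (9 / 125) ≤ 1.074656 := by
  have h := Real.exp_bound' (x := 9 / 125) (by norm_num) (by norm_num) (n := 5) (by norm_num)
  refine h.trans ?_
  simp only [Finset.sum_range_succ, Finset.sum_range_zero, Nat.factorial]
  norm_num

/-- `e^{97/500} ≤ 1.2142`. [folklore] -/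
theorem exp_ninetyseven_fivehundredths_le : Real.exp (97 / 500) ≤ 1.2142 := by
  have h := Real.exp_bound' (x := 97 / 500) (by norm_num) (by norm_num) (n := 5) (by norm_num)
  refine h.trans ?_
  simp only [Finset.sum_range_succ, Finset.sum_range_zero, Nat.factorial]
  norm_num

/-- `e^{23/50} ≤ 1.584095` (used by the `d = 3` and `SU(3)` row files). [folklore] -/
theorem exp_046_le : Real.exp (23 / 50) ≤ 1.584095 := by
  have h := Real.exp_bound' (x := 23 / 50) (by norm_num) (by norm_num) (n := 5) (by norm_num)
  refine h.trans ?_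
  simp only [Finset.sum_range_succ, Finset.sum_range_zero, Nat.factorial]
  norm_num

/-- `√2 ≤ 1.41422`. [folklore] -/
theorem sqrt_two_le : Real.sqrt 2 ≤ 1.41422 := by
  rw [show (1.41422 : ℝ) = Real.sqrt (1.41422 ^ 2) by rw [Real.sqrt_sq (by norm_num)]]
  exact Real.sqrt_le_sqrt (by norm_num)

/-- The vertex row bound is monotone in the numerical majorants: for `e^{ε₀} ≤ E` and `√N ≤ S`,
`rhoFR N cW ε₀ ε₁ ≤ max (E (1 + 2 S ε₁) cW) (E cW + S ε₁)` (`cW, ε₁ ≥ 0`). [folklore] -/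
theorem rhoFR_le_of_bounds {N : ℕ} {cW ε₀ ε₁ E S : ℝ} (hcW : 0 ≤ cW) (hε₁ : 0 ≤ ε₁) (hE : Real.exp ε₀ ≤ E)
    (hS : Real.sqrt N ≤ S) : rhoFR N cW ε₀ ε₁ ≤ max (E * (1 + 2 * S * ε₁) * cW) (E * cW + S * ε₁) := by
  unfold rhoFR
  have hE0 : 0 ≤ E := (Real.exp_pos _).le.trans hE
  have hS0 : 0 ≤ S := (Real.sqrt_nonneg _).trans hS
  refine max_le_max ?_ ?_
  · have h1 : 1 + 2 * Real.sqrt N * ε₁ ≤ 1 + 2 * S * ε₁ := by nlinarith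
    have h2 : 0 ≤ 1 + 2 * Real.sqrt N * ε₁ := by positivity
    calc Real.exp ε₀ * (1 + 2 * Real.sqrt N * ε₁) * cW ≤ E * (1 + 2 * Real.sqrt N * ε₁) * cW :=
          mul_le_mul_of_nonneg_right (mul_le_mul_of_nonneg_right hE h2) hcW
      _ ≤ E * (1 + 2 * S * ε₁) * cW := mul_le_mul_of_nonneg_right (mul_le_mul_of_nonneg_left h1 hE0) hcW
  · exact add_le_add (mul_le_mul_of_nonneg_right hE hcW) (mul_le_mul_of_nonneg_right hS hε₁)

/-! ### The certified rows `ρ < 1` -/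

/-- Row `(β_W, ε) = (1/8, 13/100)`, quarter door: `rhoFR 2 (9/16) (13/50) (13/100) < 1` (`≈ 0.9978`). [folklore] -/
theorem rhoFR_su2_quarter_oneEighth_lt_one : rhoFR 2 (9 / 16) (13 / 50) (13 / 100) < 1 := by
  refine lt_of_le_of_lt (rhoFR_le_of_bounds (by norm_num) (by norm_num) exp_thirteen_fiftieths_le sqrt_two_le) ?_
  norm_num

/-- Row `(β_W, ε) = (1/8, 97/1000)` (the radius of the Targets' variance-door row, inside the quarter door's
`13/100`): `rhoFR 2 (9/16) (97/500) (97/1000) < 1` (`≈ 0.870`). [folklore] -/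
theorem rhoFR_su2_quarter_oneEighth_097_lt_one : rhoFR 2 (9 / 16) (97 / 500) (97 / 1000) < 1 := by
  refine lt_of_le_of_lt (rhoFR_le_of_bounds (by norm_num) (by norm_num) exp_ninetyseven_fivehundredths_le sqrt_two_le) ?_
  norm_num

/-- Row `(β_W, ε) = (1/6, 31/500)`, quarter door: `rhoFR 2 (3/4) (31/250) (31/500) < 1` (`≈ 0.9979`). [folklore] -/
theorem rhoFR_su2_quarter_oneSixth_lt_one : rhoFR 2 (3 / 4) (31 / 250) (31 / 500) < 1 := by
  refine lt_of_le_of_lt (rhoFR_le_of_bounds (by norm_num) (by norm_num) exp_thirtyone_twofiftieths_le sqrt_two_le) ?_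
  norm_num

/-- Row `(β_W, ε) = (1/5, 11/500)`, quarter door: `rhoFR 2 (9/10) (11/250) (11/500) < 1` (`≈ 0.9990`). [folklore] -/
theorem rhoFR_su2_quarter_oneFifth_lt_one : rhoFR 2 (9 / 10) (11 / 250) (11 / 500) < 1 := by
  refine lt_of_le_of_lt (rhoFR_le_of_bounds (by norm_num) (by norm_num) exp_eleven_twofiftieths_le sqrt_two_le) ?_
  norm_num

/-- Tier-2 row `(β_W, κ, ε) = (1/8, log(6/5), 43/500)`, quarter door × `e^{κ}`: `rhoFR 2 (27/40) (43/250) (43/500) < 1`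
(`≈ 0.9967`). [folklore] -/
theorem rhoFR_su2_quarter_oneEighth_w65_lt_one : rhoFR 2 (27 / 40) (43 / 250) (43 / 500) < 1 := by
  refine lt_of_le_of_lt (rhoFR_le_of_bounds (by norm_num) (by norm_num) exp_fortythree_twofiftieths_le sqrt_two_le) ?_
  norm_num

/-- Tier-2 row `(β_W, κ, ε) = (1/8, log(3/2), 9/250)`, quarter door × `e^{κ}`: `rhoFR 2 (27/32) (9/125) (9/250) < 1`
(`≈ 0.9991`). [folklore] -/
theorem rhoFR_su2_quarter_oneEighth_w32_lt_one : rhoFR 2 (27 / 32) (9 / 125) (9 / 250) < 1 := by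
  refine lt_of_le_of_lt (rhoFR_le_of_bounds (by norm_num) (by norm_num) exp_nine_onetwentyfifths_le sqrt_two_le) ?_
  norm_num

/-- A `rhoFR` with `cW > 0` is positive. [folklore] -/
theorem rhoFR_pos {N : ℕ} {cW ε₀ ε₁ : ℝ} (hcW : 0 < cW) (hε₁ : 0 ≤ ε₁) : 0 < rhoFR N cW ε₀ ε₁ :=
  lt_of_lt_of_le (by positivity) (le_max_left _ _)

/-! ### The rows as torus-clustering theorems -/

/-- **The quarter-door torus clustering currency for `SU(2)`, `d = 4`, at Wilson coupling `β_W ≤ 2/3`** (tree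
coupling `β_W/2`): if `rhoFR 2 ((9/2) β_W) ε₀ ε₁ < 1` then every member of `ClusterDomainFR ε₀ ε₁ r` clusters on every
torus `L ≥ 3` with constant `16` and rate `−log ρ / (r ⊔ 1)` — `torusClusteringOnBall_of_oneLinkKRModulus` on the
tree's quarter modulus `OneLinkKRModulus 2 (3β_W/2) 1`. [folklore] -/
theorem su2_torusClusteringOnBall_quarter {βW ε₀ ε₁ : ℝ} (hβ0 : 0 < βW) (hβ : βW ≤ 2 / 3) (hε₀ : 0 ≤ ε₀)
    (hε₁ : 0 ≤ ε₁) (r : ℕ) (hρ1 : rhoFR 2 (9 / 2 * βW) ε₀ ε₁ < 1) :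
    TorusClusteringOnBall 2 4 (βW / 2) ε₀ ε₁ r 16 (-Real.log (rhoFR 2 (9 / 2 * βW) ε₀ ε₁) / max r 1) := by
  have hmod : OneLinkKRModulus 2 (3 * βW / 2) 1 := by
    have h := QuarterModulusTwoThirds.oneLinkKRModulusSU2_of_le_twoThirds hβ
    unfold OneLinkKRModulusSU2 at h
    norm_num at h
    exact h
  have hR : |βW / 2| / ((2 : ℕ) : ℝ) * (2 * (((4 : ℕ) : ℝ) - 1)) ≤ 3 * βW / 2 := by
    rw [abs_of_pos (by positivity)]
    push_cast
    linarith
  have hcW : (1 : ℝ) * (|βW / 2| / ((2 : ℕ) : ℝ)) * (6 * (((4 : ℕ) : ℝ) - 1)) = 9 / 2 * βW := by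
    rw [abs_of_pos (by positivity)]
    push_cast
    ring
  have hρ0 : 0 < rhoFR 2 (9 / 2 * βW) ε₀ ε₁ := rhoFR_pos (by positivity) hε₁
  have h := torusClusteringOnBall_of_oneLinkKRModulus (d := 4) (N := 2) (by norm_num) (by norm_num) (β := βW / 2)
    zero_le_one hR hmod hε₀ hε₁ r (by rw [hcW]; exact hρ0) (by rw [hcW]; exact hρ1)
  have h16 : (8 : ℝ) * ((2 : ℕ) : ℝ) = 16 := by norm_num
  rw [hcW, h16] at h
  exact h

/-- **ROW `(β_W, ε) = (1/8, 13/100)`, quarter door** — every member of `ClusterDomainFR (13/50) (13/100) r` on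
every torus `(ℤ/L)⁴`, `L ≥ 3`, clusters at tree coupling `1/16` with constant `16` and rate
`−log(rhoFR 2 (9/16) (13/50) (13/100)) / (r ⊔ 1) > 0`; HYPOTHESIS-FREE. [folklore] -/
theorem su2_torusClusteringOnBall_oneEighth_quarter (r : ℕ) :
    TorusClusteringOnBall 2 4 (1 / 16) (13 / 50) (13 / 100) r 16
      (-Real.log (rhoFR 2 (9 / 16) (13 / 50) (13 / 100)) / max r 1) := by
  have e1 : (1 : ℝ) / 8 / 2 = 1 / 16 := by norm_num
  have e2 : (9 : ℝ) / 2 * (1 / 8) = 9 / 16 := by norm_num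
  have h := su2_torusClusteringOnBall_quarter (βW := 1 / 8) (ε₀ := 13 / 50) (ε₁ := 13 / 100) (by norm_num)
    (by norm_num) (by norm_num) (by norm_num) r (by rw [e2]; exact rhoFR_su2_quarter_oneEighth_lt_one)
  rw [e1, e2] at h
  exact h

/-- Row `(β_W, ε) = (1/8, 97/1000)` through the quarter door (covers the Targets' variance-door radius);
HYPOTHESIS-FREE. [folklore] -/
theorem su2_torusClusteringOnBall_oneEighth_097_quarter (r : ℕ) :
    TorusClusteringOnBall 2 4 (1 / 16) (97 / 500) (97 / 1000) r 16
      (-Real.log (rhoFR 2 (9 / 16) (97 / 500) (97 / 1000)) / max r 1) := by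
  have e1 : (1 : ℝ) / 8 / 2 = 1 / 16 := by norm_num
  have e2 : (9 : ℝ) / 2 * (1 / 8) = 9 / 16 := by norm_num
  have h := su2_torusClusteringOnBall_quarter (βW := 1 / 8) (ε₀ := 97 / 500) (ε₁ := 97 / 1000) (by norm_num)
    (by norm_num) (by norm_num) (by norm_num) r (by rw [e2]; exact rhoFR_su2_quarter_oneEighth_097_lt_one)
  rw [e1, e2] at h
  exact h

/-- **ROW `(β_W, ε) = (1/6, 31/500)`, quarter door** (tree coupling `1/12`); HYPOTHESIS-FREE. [folklore] -/
theorem su2_torusClusteringOnBall_oneSixth_quarter (r : ℕ) :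
    TorusClusteringOnBall 2 4 (1 / 12) (31 / 250) (31 / 500) r 16
      (-Real.log (rhoFR 2 (3 / 4) (31 / 250) (31 / 500)) / max r 1) := by
  have e1 : (1 : ℝ) / 6 / 2 = 1 / 12 := by norm_num
  have e2 : (9 : ℝ) / 2 * (1 / 6) = 3 / 4 := by norm_num
  have h := su2_torusClusteringOnBall_quarter (βW := 1 / 6) (ε₀ := 31 / 250) (ε₁ := 31 / 500) (by norm_num)
    (by norm_num) (by norm_num) (by norm_num) r (by rw [e2]; exact rhoFR_su2_quarter_oneSixth_lt_one)
  rw [e1, e2] at h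
  exact h

/-- **ROW `(β_W, ε) = (1/5, 11/500)`, quarter door** (tree coupling `1/10`); HYPOTHESIS-FREE. [folklore] -/
theorem su2_torusClusteringOnBall_oneFifth_quarter (r : ℕ) :
    TorusClusteringOnBall 2 4 (1 / 10) (11 / 250) (11 / 500) r 16
      (-Real.log (rhoFR 2 (9 / 10) (11 / 250) (11 / 500)) / max r 1) := by
  have e1 : (1 : ℝ) / 5 / 2 = 1 / 10 := by norm_num
  have e2 : (9 : ℝ) / 2 * (1 / 5) = 9 / 10 := by norm_num
  have h := su2_torusClusteringOnBall_quarter (βW := 1 / 5) (ε₀ := 11 / 250) (ε₁ := 11 / 500) (by norm_num)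
    (by norm_num) (by norm_num) (by norm_num) r (by rw [e2]; exact rhoFR_su2_quarter_oneFifth_lt_one)
  rw [e1, e2] at h
  exact h

/-- **The quarter-door TIER-2 torus clustering currency for `SU(2)`, `d = 4`** (`0 < β_W ≤ 2/3`, weight `κ ≥ 0`):
if `rhoFR 2 (e^{κ} (9/2) β_W) ε₀ ε₁ < 1` then every member of the diameter-weighted ball `ClusterDomain κ ε₀ ε₁` clusters
on every torus `L ≥ 3` with constant `16` and rate `κ`. [folklore] -/
theorem su2_torusClusteringOnBallW_quarter {βW κ ε₀ ε₁ : ℝ} (hβ0 : 0 < βW) (hβ : βW ≤ 2 / 3) (hκ : 0 ≤ κ)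
    (hε₀ : 0 ≤ ε₀) (hε₁ : 0 ≤ ε₁) (hρ1 : rhoFR 2 (Real.exp κ * (9 / 2 * βW)) ε₀ ε₁ < 1) :
    TorusClusteringOnBallW 2 4 (βW / 2) κ ε₀ ε₁ 16 κ := by
  have hmod : OneLinkKRModulus 2 (3 * βW / 2) 1 := by
    have h := QuarterModulusTwoThirds.oneLinkKRModulusSU2_of_le_twoThirds hβ
    unfold OneLinkKRModulusSU2 at h
    norm_num at h
    exact h
  have hR : |βW / 2| / ((2 : ℕ) : ℝ) * (2 * (((4 : ℕ) : ℝ) - 1)) ≤ 3 * βW / 2 := by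
    rw [abs_of_pos (by positivity)]
    push_cast
    linarith
  have hcW : Real.exp κ * (1 : ℝ) * (|βW / 2| / ((2 : ℕ) : ℝ)) * (6 * (((4 : ℕ) : ℝ) - 1)) = Real.exp κ * (9 / 2 * βW) := by
    rw [abs_of_pos (by positivity)]
    push_cast
    ring
  have h := torusClusteringOnBallW_of_oneLinkKRModulus (d := 4) (N := 2) (by norm_num) (by norm_num) (β := βW / 2)
    zero_le_one hκ hR hmod hε₀ hε₁ (by rw [hcW]; exact hρ1)
  have h16 : (8 : ℝ) * ((2 : ℕ) : ℝ) = 16 := by norm_num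
  rw [h16] at h
  exact h

/-- **TIER-2 ROW `(β_W, κ, ε) = (1/8, log(6/5), 43/500)`**: every member of `ClusterDomain (log(6/5)) (43/250) (43/500)` on
every torus `(ℤ/L)⁴`, `L ≥ 3`, clusters at tree coupling `1/16` with constant `16` and RATE `log(6/5)` per lattice unit;
HYPOTHESIS-FREE (HEADLINE-CANDIDATES 2b). [folklore] -/
theorem su2_torusClusteringOnBallW_oneEighth_w65 :
    TorusClusteringOnBallW 2 4 (1 / 16) (Real.log (6 / 5)) (43 / 250) (43 / 500) 16 (Real.log (6 / 5)) := by
  have e1 : (1 : ℝ) / 8 / 2 = 1 / 16 := by norm_num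
  have e2 : Real.exp (Real.log (6 / 5)) * ((9 : ℝ) / 2 * (1 / 8)) = 27 / 40 := by
    rw [Real.exp_log (by norm_num)]; norm_num
  have h := su2_torusClusteringOnBallW_quarter (βW := 1 / 8) (κ := Real.log (6 / 5)) (ε₀ := 43 / 250) (ε₁ := 43 / 500)
    (by norm_num) (by norm_num) (Real.log_nonneg (by norm_num)) (by norm_num) (by norm_num)
    (by rw [e2]; exact rhoFR_su2_quarter_oneEighth_w65_lt_one)
  rw [e1] at h
  exact h

/-- **TIER-2 ROW `(β_W, κ, ε) = (1/8, log(3/2), 9/250)`**: rate `log(3/2)` per lattice unit on `ClusterDomain (log(3/2))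
(9/125) (9/250)`; HYPOTHESIS-FREE. [folklore] -/
theorem su2_torusClusteringOnBallW_oneEighth_w32 :
    TorusClusteringOnBallW 2 4 (1 / 16) (Real.log (3 / 2)) (9 / 125) (9 / 250) 16 (Real.log (3 / 2)) := by
  have e1 : (1 : ℝ) / 8 / 2 = 1 / 16 := by norm_num
  have e2 : Real.exp (Real.log (3 / 2)) * ((9 : ℝ) / 2 * (1 / 8)) = 27 / 32 := by
    rw [Real.exp_log (by norm_num)]; norm_num
  have h := su2_torusClusteringOnBallW_quarter (βW := 1 / 8) (κ := Real.log (3 / 2)) (ε₀ := 9 / 125) (ε₁ := 9 / 250)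
    (by norm_num) (by norm_num) (Real.log_nonneg (by norm_num)) (by norm_num) (by norm_num)
    (by rw [e2]; exact rhoFR_su2_quarter_oneEighth_w32_lt_one)
  rw [e1] at h
  exact h

/-- **Targets row `RowClusteringSU2OneEighthQuarter` holds**: `∃ A m, 0 < m ∧ TorusClusteringOnBall 2 4 (1/16)
(13/50) (13/100) 2 A m`, with `A = 16`, `m = −log(rhoFR 2 (9/16) (13/50) (13/100))/2 > 0`. [folklore] -/
theorem rowClusteringSU2OneEighthQuarter_holds : RowClusteringSU2OneEighthQuarter := by
  refine ⟨16, _, ?_, su2_torusClusteringOnBall_oneEighth_quarter 2⟩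
  have hρ0 : 0 < rhoFR 2 (9 / 16) (13 / 50) (13 / 100) := rhoFR_pos (by norm_num) (by norm_num)
  have hlog : Real.log (rhoFR 2 (9 / 16) (13 / 50) (13 / 100)) < 0 := Real.log_neg hρ0 rhoFR_su2_quarter_oneEighth_lt_one
  exact div_pos (neg_pos.2 hlog) (Nat.cast_pos.2 (by norm_num))

/-- **Targets row `RowClusteringSU2OneEighth` holds** (`∃ A m, 0 < m ∧ TorusClusteringOnBall 2 4 (1/16) (97/500)
(97/1000) 2 A m`) — typed by rb-theory for the variance door, discharged here through the QUARTER door, whose radius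
`13/100` at `β_W = 1/8` contains `97/1000`. [folklore] -/
theorem rowClusteringSU2OneEighth_holds : RowClusteringSU2OneEighth := by
  refine ⟨16, _, ?_, su2_torusClusteringOnBall_oneEighth_097_quarter 2⟩
  have hρ0 : 0 < rhoFR 2 (9 / 16) (97 / 500) (97 / 1000) := rhoFR_pos (by norm_num) (by norm_num)
  have hlog : Real.log (rhoFR 2 (9 / 16) (97 / 500) (97 / 1000)) < 0 :=
    Real.log_neg hρ0 rhoFR_su2_quarter_oneEighth_097_lt_one
  exact div_pos (neg_pos.2 hlog) (Nat.cast_pos.2 (by norm_num))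

end Summit.Ventures.YMGap.RobustBall

end
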